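import Summits.ResolutionOfSingularities.ResolutionOfSingularities.Theorems.PurelyInseparableDim4EquimultipleEdge
import Summits.ResolutionOfSingularities.ResolutionOfSingularities.Theorems.PurelyInseparableDim4MohAlongOrdAlongKept
import HarnessLib

/-!
# Purely inseparable four-folds `z^p + F(x₁, …, x₄)`: THE STATE AFTER THE FAR-RESONANCE REPAIR IS NON-ZERO, CLEAN AND `T`-PERMISSIBLE
# (cell `res-dim4-pi`, typ-2 g8; companion of `farRepair_chart_reading(_heights)` p723027 / p724360 — typ-3's `MemberDataAT` clause 1 for the
# new main reading after the sub-centre step)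

[OURS · counted 0] (D-0157 DOOR 2; DR-157-C.) The post-repair state is `(CentreBlowup.step p (insert j T) j 0 ⟨F₁(y_j + h), …⟩).F` (one height), resp.
the fold of such steps over consecutive height differences (p724360). The translated polynomial `F₁(y_j + h)` is in general NOT clean, so the tree's
`Equimultiple.step_F_ne_zero_of_isClean` does not apply verbatim. PROVED here (no `sorry`, no new axiom):

* `isPthPowerExponent_chartExponent` — the chart law at `q = p` carries `p`-th power exponents to `p`-th power exponents;
* `deletePthPowers_chartTransform_eq_zero` — hence the chart transform of a sum of `p`-th powers cleans to `0`;
* **`step_zero_F_eq_step_deletePthPowers`** — `(step p S j 0 s).F = (step p S j 0 ⟨deletePthPowers p s.F, …⟩).F`: at the origin of a chart one may clean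
  BEFORE the step;
* **`farRepair_state_ne_zero`**, `farRepair_state_isClean`, `farRepair_state_permissible` — for `F₁ ≠ 0` clean and `T`-permissible, `j ∉ T`, any `h`:
  `(step p (insert j T) j 0 ⟨F₁(y_j + h), r, exc⟩).F` is non-zero (p-1's `MohAlong.ordAlong_deletePthPowers_translate` + `step_F_ne_zero_of_isClean`), clean,
  and `T`-permissible (p721320);
* **`farRepair_states_ne_zero_isClean_permissible`** — the same three facts for the many-heights fold of p724360, by induction on the heights.

Nothing here is a statement about resolution of singularities in dimension ≥ 4 / characteristic `p` (NOT proved anywhere in this programme).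
bears_on: LADDER-RESOLUTION:D157-DOOR2 (res-dim4-pi). Supports stmt-ResolutionOfSingularities-16155 (helper).
-/

-- every declaration of this summit lives under `Summit.ResolutionOfSingularities.ResolutionOfSingularities`
-- (summit = problem), which the duplicate-namespace linter flags; house convention (cf. the Target file).
set_option linter.dupNamespace false

noncomputable section

open MvPolynomial

namespace Summit.ResolutionOfSingularities.ResolutionOfSingularities.Theorems.PIDim4

open Literature.AlgebraicGeometry.Resolution
open Literature.AlgebraicGeometry.Resolution.Hauser2010
open Literature.Barriers.ResolutionOfSingularities

namespace ChartDictionary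

/-! ## §1 Cleaning before or after a step at the origin of a chart -/

section CleanStep

variable {K : Type} [Field K] {p : ℕ} [hp : Fact p.Prime]

omit hp in
/-- **The chart law carries `p`-th power exponents to `p`-th power exponents** (`q = p`): off `j` nothing changes; at `j` the new exponent is
`Σ_{i ∈ S} dᵢ − p`, a difference of multiples of `p`. -/
theorem isPthPowerExponent_chartExponent (S : Finset (Fin 4)) (j : Fin 4) {d : Fin 4 →₀ ℕ} (hd : IsPthPowerExponent p d) :
    IsPthPowerExponent p (CentreBlowup.chartExponent p S j d) := by
  classical
  have hdiv : ∀ i, p ∣ d i := fun i => by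
    by_cases hi : i ∈ d.support
    · exact hd i hi
    · rw [Finsupp.notMem_support_iff.mp hi]; exact dvd_zero p
  intro i _
  unfold CentreBlowup.chartExponent
  rw [Finsupp.update_apply]
  split_ifs with hij
  · exact Nat.dvd_sub (Finset.dvd_sum fun i _ => hdiv i) (dvd_refl p)
  · exact hdiv i

omit hp in
/-- **The chart transform of a sum of `p`-th powers cleans to zero.** -/
theorem deletePthPowers_chartTransform_eq_zero [DecidableEq K] (S : Finset (Fin 4)) (j : Fin 4) {R : MvPolynomial (Fin 4) K}
    (hR : ∀ d ∈ R.support, IsPthPowerExponent p d) : deletePthPowers p (CentreBlowup.chartTransform p S j R) = 0 := by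
  classical
  ext e
  rw [coeff_deletePthPowers, coeff_zero]
  split_ifs with he
  · rfl
  · by_contra hne
    have hmem : e ∈ (CentreBlowup.chartTransform p S j R).support := MvPolynomial.mem_support_iff.mpr hne
    unfold CentreBlowup.chartTransform at hmem
    obtain ⟨d, hd, hed⟩ := Finset.mem_biUnion.mp (MvPolynomial.support_sum hmem)
    have heq : e = CentreBlowup.chartExponent p S j d := by
      have := support_monomial_subset hed
      rwa [Finset.mem_singleton] at this
    exact he (heq ▸ isPthPowerExponent_chartExponent S j (hR d hd))

omit hp in
/-- The `p`-th power part of a polynomial: `P − deletePthPowers p P` has only `p`-th power monomials. -/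
theorem isPthPowerExponent_of_mem_support_sub_deletePthPowers [DecidableEq K] (P : MvPolynomial (Fin 4) K) :
    ∀ d ∈ (P - deletePthPowers p P).support, IsPthPowerExponent p d := by
  classical
  intro d hd
  by_contra hnd
  rw [MvPolynomial.mem_support_iff, coeff_sub, coeff_deletePthPowers, if_neg hnd, sub_self] at hd
  exact hd rfl

omit hp in
/-- **At the origin of a chart one may clean before the step**: `(step p S j 0 s).F = (step p S j 0 ⟨deletePthPowers p s.F, s.r, s.exc⟩).F`. -/
theorem step_zero_F_eq_step_deletePthPowers [DecidableEq K] (S : Finset (Fin 4)) (j : Fin 4) (s : State K) :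
    (CentreBlowup.step p S j 0 s).F = (CentreBlowup.step p S j 0 ⟨deletePthPowers p s.F, s.r, s.exc⟩).F := by
  classical
  change deletePthPowers p (PointBlowup.translate 0 (CentreBlowup.chartTransform p S j s.F)) =
    deletePthPowers p (PointBlowup.translate 0 (CentreBlowup.chartTransform p S j (deletePthPowers p s.F)))
  rw [PointBlowup.translate_zero, PointBlowup.translate_zero]
  conv_lhs => rw [show s.F = deletePthPowers p s.F + (s.F - deletePthPowers p s.F) by rw [add_sub_cancel]]
  rw [CentreBlowup.chartTransform_add, deletePthPowers_add,
    deletePthPowers_chartTransform_eq_zero S j (isPthPowerExponent_of_mem_support_sub_deletePthPowers s.F), add_zero]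

end CleanStep

/-! ## §2 The post-repair state -/

section State

variable {K : Type} [Field K] {p : ℕ} [hp : Fact p.Prime] [CharP K p] [DecidableEq K] {T : Finset (Fin 4)} {j : Fin 4}

/-- **The post-repair state is NON-ZERO**: `F₁ ≠ 0` clean and `T`-permissible, `j ∉ T`, any height `h`, any bookkeeping `r`, `exc`. -/
theorem farRepair_state_ne_zero (hjT : j ∉ T) {F₁ : MvPolynomial (Fin 4) K} (hF : F₁ ≠ 0) (hclean : HauserPerlega.IsClean p F₁)
    (hperm : (p : ℕ∞) ≤ CentreBlowup.ordAlong T F₁) (h : K) (r : Fin 4 →₀ ℕ) (exc : Finset (Fin 4)) :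
    (CentreBlowup.step p (insert j T) j 0 ⟨PointBlowup.translate (Pi.single j h) F₁, r, exc⟩).F ≠ 0 := by
  rw [step_zero_F_eq_step_deletePthPowers]
  have hc : ∀ i ∈ T, Pi.single (M := fun _ => K) j h i = 0 := fun i hi => Pi.single_eq_of_ne (ne_of_mem_of_not_mem hi hjT) _
  have hord : CentreBlowup.ordAlong T (deletePthPowers p (PointBlowup.translate (Pi.single j h) F₁)) = CentreBlowup.ordAlong T F₁ :=
    MohAlong.ordAlong_deletePthPowers_translate p (Pi.single j h) hc (HauserPerlega.deletePthPowers_eq_self hclean)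
  refine Equimultiple.step_F_ne_zero_of_isClean (Finset.mem_insert_self j T) 0 _ ?_ (HauserPerlega.isClean_deletePthPowers p _) ?_
  · intro h0
    have h0' : deletePthPowers p (PointBlowup.translate (Pi.single j h) F₁) = 0 := h0
    have h1 : CentreBlowup.ordAlong T (deletePthPowers p (PointBlowup.translate (Pi.single j h) F₁)) = ⊤ := by
      rw [h0', CentreBlowup.ordAlong_zero]
    rw [hord, CentreBlowup.ordAlong_eq_top_iff] at h1
    exact hF h1
  · change (p : ℕ∞) ≤ CentreBlowup.ordAlong (insert j T) (deletePthPowers p (PointBlowup.translate (Pi.single j h) F₁))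
    rw [← hord] at hperm
    exact hperm.trans (CentreBlowup.ordAlong_mono (Finset.subset_insert j T) _)

omit hp [CharP K p] in
/-- **The post-repair state is CLEAN** (it is an output of the tree's `step`). -/
theorem farRepair_state_isClean (s : State K) :
    HauserPerlega.IsClean p (CentreBlowup.step p (insert j T) j 0 s).F :=
  HauserPerlega.isClean_deletePthPowers p _

omit hp [CharP K p] in
/-- **The post-repair state is `T`-PERMISSIBLE** (p721320: `j ∉ T`, point over `V(x_T)`). -/
theorem farRepair_state_permissible (hjT : j ∉ T) {F₁ : MvPolynomial (Fin 4) K} (hperm : (p : ℕ∞) ≤ CentreBlowup.ordAlong T F₁) (h : K)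
    (r : Fin 4 →₀ ℕ) (exc : Finset (Fin 4)) :
    (p : ℕ∞) ≤ CentreBlowup.ordAlong T (CentreBlowup.step p (insert j T) j 0 ⟨PointBlowup.translate (Pi.single j h) F₁, r, exc⟩).F := by
  refine MohAlong.equimultiple_kept hjT (insert j T) (fun _ _ => rfl) ?_
  change (p : ℕ∞) ≤ CentreBlowup.ordAlong T (PointBlowup.translate (Pi.single j h) F₁)
  rw [MohAlong.ordAlong_translate (Pi.single j h) (fun i hi => Pi.single_eq_of_ne (ne_of_mem_of_not_mem hi hjT) _) F₁]
  exact hperm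

/-- **THE MANY-HEIGHTS FOLD OF p724360 KEEPS THE STATE NON-ZERO, CLEAN AND `T`-PERMISSIBLE**: for `F ≠ 0` clean `T`-permissible, `j ∉ T`, any list of
heights and any starting offset `a`. -/
theorem farRepair_states_ne_zero_isClean_permissible (hjT : j ∉ T) (hs : List K) :
    ∀ (a : K) (F : MvPolynomial (Fin 4) K), F ≠ 0 → HauserPerlega.IsClean p F → (p : ℕ∞) ≤ CentreBlowup.ordAlong T F →
      let out := hs.foldl (fun (acc : K × MvPolynomial (Fin 4) K) (h : K) =>
        (h, (CentreBlowup.step p (insert j T) j 0 ⟨PointBlowup.translate (Pi.single j (h - acc.1)) acc.2, 0, ∅⟩).F)) (a, F)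
      out.2 ≠ 0 ∧ HauserPerlega.IsClean p out.2 ∧ (p : ℕ∞) ≤ CentreBlowup.ordAlong T out.2 := by
  induction hs with
  | nil => intro a F hF hclean hperm; exact ⟨hF, hclean, hperm⟩
  | cons h hs' ih =>
    intro a F hF hclean hperm
    simp only [List.foldl_cons]
    exact ih h _ (farRepair_state_ne_zero hjT hF hclean hperm (h - a) 0 ∅) (farRepair_state_isClean _)
      (farRepair_state_permissible hjT hperm (h - a) 0 ∅)

end State

end ChartDictionary

end Summit.ResolutionOfSingularities.ResolutionOfSingularities.Theorems.PIDim4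

end
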